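import Summits.BirchSwinnertonDyer.Rank1Residual.ManinAdditive.MinusOneLevelRaisingGeneralProof
import Summits.BirchSwinnertonDyer.Rank1Residual.ManinAdditive.MinusOneLevelRaisingGeneralDegree
import Summits.BirchSwinnertonDyer.Rank1Residual.ManinAdditive.CuspidalKummerUFamilyCurve
import Summits.BirchSwinnertonDyer.BirchSwinnertonDyer.Theses.ManinLocalTwoThree
import Literature.NumberTheory.EllipticCurves.ManinConstantModularDegree
import Literature.NumberTheory.EllipticCurves.QuadraticTwistJInvariantProofs
import Literature.NumberTheory.EllipticCurves.IsogenyQuadraticTwistProofs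
import Literature.NumberTheory.EllipticCurves.IsogenyDualProofs
import Literature.NumberTheory.EllipticCurves.IsogenyCompProofs
import Literature.NumberTheory.EllipticCurves.CuspFormLFunctionLevelConductorProofs
import HarnessLib

/-!
# ČNS transport along the `χ₋₄` orbit; the odd half of the totally-blind `u`-family (an g32 §12, landing file B6)

Cell bsd-f2-manin, ANALYTIC lens, gen 32 (MEMO-an §75.11).  Imports the LANDED B5a
(`MinusOneLevelRaisingGeneralProof`, p696558: `minusOneTwistRotation_general`, `minusOneTwistOptimalOrbit_general`),
the typer's B5c-to-be (`MinusOneLevelRaisingGeneralDegree`: `modularDegree_eq_mul_of_orbit_general` — fix the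
module name if it lands elsewhere), the tree's datum theorem
`PlusEtaManinInput.exists_modularParametrizationData_eq_of_smul_periodLattice_le`, and the named print fact
`cesnaviciusNeururerSaha_padicVal_maninConstant_le_modularDegree` (Česnavičius–Neururer–Saha, JEMS 2024, Thm 1.2).

* `half_gaussSum_χ₄_twoSided_of_isNewformOf_general` (an: `…_of_isNewformOf`; renamed, see the typer note) — the landed two-sided lattice step `half_gaussSum_χ₄_twoSided_general`
  with the datum `D` on the small curve replaced by a BARE newform `(f, hf : IsNewformOf W f)` (same proof; needed
  downward, where the small curve carries no datum yet);
* `exists_optimalPartner_down` — DOWNWARD lattice-optimal `χ₋₄`-partner at conductor `N/m` (`m ∣ 4`) with the SAME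
  Manin constant and `deg = m · deg′` (modulo modularity `exists_isNewformOf` only);
* `two_not_dvd_c_of_CNS`, `two_not_dvd_c_down_of_CNS` — ČNS at `p = 2` directly, and transported down the orbit;
* `IsUFamilyCurve`, candidates S-an-64 `UFamilyConductorLaw`, E-an-150 `UFamilyOddDegreeAtFour`, and
  `uFamily_two_not_dvd_c_of_odd`: `2 ∤ c` for every lattice-optimal conductor-level datum on a `u`-family curve
  `y² = (x+u)(x²+4)` with `u` odd — modulo modularity, ČNS, S-an-64, E-an-150.

Verified as text: HOME/an/g32/MinusOneLevelRaisingProofs_concat9.lean (tree B3 text + B4 + B5(refactored) + §12):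
rc 0 · 0 · 0 · 0, `--axioms …uFamily_two_not_dvd_c_of_odd` = [propext, Classical.choice, Quot.sound].
PARTITION 0 · beyond-print theorem: yes (the transport; print ČNS is void on `16(u²+4)`) · BSD is not proved by
this · the route crux C2 `ManinOddAtFour` stays OPEN.
TYPER NOTE (typer g17, TURNKEY-an-26).  an's HOME/an/g32/MinusOneLevelRaisingCNSTransportProof.lean sha16 966314cf4216aa25
(404 l. > the 400-line cap) landed VERBATIM in two pieces: the DEFINITIONS of its `### Application` section (`IsUFamilyCurve`,
S-an-64 `UFamilyConductorLaw`, E-an-150 `UFamilyOddDegreeAtFour` + two curve lemmas) went FIRST into the dependency-light statement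
leaf `CuspidalKummerUFamilyCurve.lean` (p697376, so that the width provers can discharge S-an-64 by name at once — p3 g12), and
this file (an's module name) = the general step + §`DownwardAndCNS` + the assembled application theorem
`uFamily_two_not_dvd_c_of_odd`.  ONE rename forced by the tree: an's `half_gaussSum_χ₄_twoSided_of_isNewformOf` (bare-newform
form of B5a's `_general`) collides with the landed B3 declaration of the same name (datum form, `N′ = 4N`), so it is
`half_gaussSum_χ₄_twoSided_of_isNewformOf_general` here (one call site).  No new `Prop` in this file; every declaration is a
kernel theorem; the ČNS input is the tree's named fact `cesnaviciusNeururerSaha_padicVal_maninConstant_le_modularDegree`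
taken as an explicit hypothesis.  BSD is not proved by this; Manin's conjecture is not proved by this; C2/C3 OPEN.
-/

open scoped MatrixGroups ModularForm
open CongruenceSubgroup WeierstrassCurve
  Literature.NumberTheory.DiophantineGeometry
  Literature.NumberTheory.EllipticCurves
  Literature.NumberTheory.EllipticCurves.ModularForms
  Summit.BirchSwinnertonDyer.BirchSwinnertonDyer.Theorems

namespace Summit.BirchSwinnertonDyer.Rank1Residual.ManinAdditive

/-- **The general two-sided exact step.** For `W ⊗ χ₋₄ ~ W′`, `4 ∣ N(W)`, `16 ∣ N(W′)`,
`N(W) ∣ N(W′)`, `N(W′) ∣ 4N(W)`, ANY `Γ₀(N(W))`-datum `D` of `W` and ANY newform `g` of `W′` at level `N(W′)`: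
`(g(χ₄)/2)·Λ(g) ⊆ Λ(f_W)` and `(g(χ₄)/2)·Λ(f_W) ⊆ Λ(g)`.  (§7's proof with the level relation relaxed to the two
divisibilities it actually uses: `charTwist` to level `N(W′)` needs `N(W) ∣ N(W′)` and `16 ∣ N(W′)`; the level-lift
S-an-56 needs `N(W′) ∣ 4N(W)` and `2 ∣ N(W)`.) [cite: Stevens1989, Lemma (5.4) p. 97] [cite: Cremona1997, §2.8] -/
theorem half_gaussSum_χ₄_twoSided_of_isNewformOf_general {W W' : WeierstrassCurve ℚ}
    [W.IsElliptic] [W'.IsElliptic] [NeZero (W.conductorNorm ℤ)] [NeZero (W'.conductorNorm ℤ)]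
    (f : CuspForm (Gamma0 (W.conductorNorm ℤ)) 2) (hf : IsNewformOf W f)
    (g : CuspForm (Gamma0 (W'.conductorNorm ℤ)) 2) (hg : IsNewformOf W' g)
    (h4 : 2 ^ 2 ∣ W.conductorNorm ℤ) (hM' : 4 ^ 2 ∣ W'.conductorNorm ℤ)
    (hNdvd : W.conductorNorm ℤ ∣ W'.conductorNorm ℤ)
    (hL : W'.conductorNorm ℤ ∣ 4 * W.conductorNorm ℤ)
    (hiso : IsIsogenous (W.quadraticTwist ((-1 : ℤ) : ℚ)) W') :
    (∀ w ∈ periodLattice g,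
      gaussSum (ZMod.χ₄.ringHomComp (Int.castRingHom ℂ)) (ZMod.stdAddChar (N := 4)) / 2 * w ∈
        periodLattice f) ∧
    (∀ w ∈ periodLattice f,
      gaussSum (ZMod.χ₄.ringHomComp (Int.castRingHom ℂ)) (ZMod.stdAddChar (N := 4)) / 2 * w ∈
        periodLattice g) := by
  haveI : Fact (Nat.Prime 2) := ⟨Nat.prime_two⟩
  haveI : NeZero (4 : ℕ) := ⟨by norm_num⟩
  haveI : NeZero (1 : ℕ) := ⟨by norm_num⟩
  have hχ : (ZMod.χ₄.ringHomComp (Int.castRingHom ℂ)).IsQuadratic := isQuadratic_χ₄_ringHomComp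
  have hprim : DirichletCharacter.IsPrimitive (ZMod.χ₄.ringHomComp (Int.castRingHom ℂ)) :=
    isPrimitive_χ₄_ringHomComp
  have hd0 : ((-1 : ℤ) : ℚ) ≠ 0 := by norm_num
  haveI := W.isElliptic_quadraticTwist hd0
  have h4nat : 4 ∣ W.conductorNorm ℤ := by norm_num at h4; exact h4
  have h2nat : 2 ∣ W.conductorNorm ℤ := dvd_trans (by norm_num) h4nat
  have h4' : 2 ^ 2 ∣ W'.conductorNorm ℤ := dvd_trans (by norm_num) hM'
  obtain ⟨hngW, hnmW⟩ := not_good_and_not_mult_of_sq_dvd_conductorNorm W h4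
  obtain ⟨hngW', hnmW'⟩ := not_good_and_not_mult_of_sq_dvd_conductorNorm W' h4'
  have hW0 : ∀ n : ℕ, 2 ∣ n → W.LFunction n = 0 := fun n hn ↦
    W.LFunction_apply_eq_zero_of_not_good_of_not_mult 2 hngW hnmW hn
  have hW'0 : ∀ n : ℕ, 2 ∣ n → W'.LFunction n = 0 := fun n hn ↦
    W'.LFunction_apply_eq_zero_of_not_good_of_not_mult 2 hngW' hnmW' hn
  have hodd : ∀ n : ℕ, ¬ 2 ∣ n → (((W.quadraticTwist ((-1 : ℤ) : ℚ)).LFunction n : ℤ) : ℂ) =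
      (ZMod.χ₄.ringHomComp (Int.castRingHom ℂ)) n * (W.LFunction n : ℂ) := fun n hn ↦ by
    rw [show ((-1 : ℤ) : ℚ) = -1 by norm_num, W.LFunction_quadraticTwist_neg_one_apply_of_odd hn,
      Int.cast_mul, χ₄_ringHomComp_apply_natCast]
  have heven : ∀ n : ℕ, 2 ∣ n → (ZMod.χ₄.ringHomComp (Int.castRingHom ℂ)) n = 0 := fun n hn ↦ by
    rw [χ₄_ringHomComp_apply_natCast, ZMod.χ₄_nat_eq_if_mod_four, if_pos (Nat.mod_eq_zero_of_dvd hn)]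
    simp
  have hsq : ∀ n : ℕ, ¬ 2 ∣ n → (ZMod.χ₄.ringHomComp (Int.castRingHom ℂ)) n *
      (ZMod.χ₄.ringHomComp (Int.castRingHom ℂ)) n = 1 := fun n hn ↦ by
    rw [χ₄_ringHomComp_apply_natCast, ZMod.χ₄_nat_eq_if_mod_four,
      if_neg (fun h ↦ hn (Nat.dvd_of_mod_eq_zero h))]
    split_ifs <;> push_cast <;> ring
  have hLC : (W.quadraticTwist ((-1 : ℤ) : ℚ)).LFunction = W'.LFunction := hiso.LFunction_eq
  have hcoef : ∀ n : ℕ, cuspCoeff g n =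
      (ZMod.χ₄.ringHomComp (Int.castRingHom ℂ)) n * cuspCoeff f n := fun n ↦ by
    rw [hg.2 n, hf.2 n]
    by_cases h2 : 2 ∣ n
    · rw [hW'0 n h2, heven n h2]
      simp
    · rw [← hLC]
      exact hodd n h2
  have hevenD : ∀ n : ℕ, 2 ∣ n → cuspCoeff f n = 0 := fun n hn ↦ by
    rw [hf.2 n, hW0 n hn, Int.cast_zero]
  have hevenD' : ∀ n : ℕ, 2 ∣ n → cuspCoeff g n = 0 := fun n hn ↦ by
    rw [hg.2 n, hW'0 n hn, Int.cast_zero]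
  -- `g = f_W ⊗ χ₄` at level `N(W′)`
  have htw' : charTwist (W'.conductorNorm ℤ) hNdvd hM' hχ f = g :=
    eq_of_forall_cuspCoeff_eq_gamma0 fun n ↦ by rw [cuspCoeff_charTwist _ hNdvd hM' hχ hprim, hcoef n]
  have hhalf : ∀ x : ℚ, modularSymbol f (x + 1 / 2) = -modularSymbol f x :=
    maninLocalTwoThree_modularSymbol_add_half_eq_neg_of_four_dvd f h4nat hevenD
  have hhalf' : ∀ x : ℚ, modularSymbol g (x + 1 / 2) = -modularSymbol g x :=
    modularSymbol_add_half_eq_neg g hM' hevenD'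
  have hm1 : 1 ^ 2 ∣ W'.conductorNorm ℤ := by rw [one_pow]; exact one_dvd _
  have hone : ∀ n : ℕ, (1 : DirichletCharacter ℂ 1) n = 1 := fun n ↦
    MulChar.one_apply (isUnit_of_subsingleton _)
  have hlift : charTwist (W'.conductorNorm ℤ) dvd_rfl hM' hχ g =
      charTwist (W'.conductorNorm ℤ) hNdvd hm1 maninLocalTwoThree_isQuadratic_one_level_one f :=
    eq_of_forall_cuspCoeff_eq_gamma0 fun n ↦ by
      rw [cuspCoeff_charTwist _ dvd_rfl hM' hχ hprim, cuspCoeff_charTwist _ hNdvd hm1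
        maninLocalTwoThree_isQuadratic_one_level_one DirichletCharacter.isPrimitive_one_level_one,
        hone n, one_mul, hcoef n, ← mul_assoc]
      by_cases hn : 2 ∣ n
      · rw [hevenD n hn, mul_zero]
      · rw [hsq n hn, one_mul]
  -- level-lift step: the tree's S-an-56 (p2 g13, p693677) for the level-`N′` lift of `f_W`, which `hlift`
  -- identifies with `g ⊗ χ₄` (same re-routing as the typer's B3; the modular-symbol identity behind it is
  -- `modularSymbol (g ⊗ χ₄) = modularSymbol f_W`, by `hlift` + `maninLocalTwoThree_modularSymbol_charTwist_one`).
  have hle : periodLattice f ≤ periodLattice (charTwist (W'.conductorNorm ℤ) dvd_rfl hM' hχ g) := by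
    rw [hlift]
    exact ManinLocalTwoThree.periodLattice_le_periodLattice_charTwist_one_of_two_dvd
      (W'.conductorNorm ℤ) hNdvd hL hm1 h2nat f
  refine ⟨fun w hw ↦ ?_, fun w hw ↦ ?_⟩
  · rw [← htw'] at hw
    exact half_gaussSum_mul_mem_periodLattice_of_mem_charTwist _ hNdvd hM' hχ hprim f
      (fun x ↦ ⟨1, 3, 0, sum_χ₄_modularSymbol_of_half f hhalf x⟩) hw
  · exact half_gaussSum_mul_mem_periodLattice_of_mem_charTwist _ dvd_rfl hM' hχ hprim g
      (fun x ↦ ⟨1, 3, 0, sum_χ₄_modularSymbol_of_half g hhalf' x⟩) (hle hw)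


/-! ## §12 — DOWNWARD `χ₋₄`-partners and ČESNAVIČIUS–NEURURER–SAHA TRANSPORT along the orbit (an g32, MEMO-an §75.11)

ČNS (tree named fact `cesnaviciusNeururerSaha_padicVal_maninConstant_le_modularDegree`, JEMS 2024 Thm 1.2, for ANY
`Γ₀(N(W))`-datum): `v₂(c) ≤ v₂(deg)` unless `8 ∣ N` and no prime `q ≡ 3 (mod 4)` divides `N`.  The `χ₋₄` orbit moves a
class at `16 ∥ N` DOWN to conductor `N/4` (tame core, `4 ∥`) or `N/2` (`8 ∥`), where the exceptional clause is void
resp. decided by the odd part of `N`, with `c′ = ±c` and `deg = m·deg′`.  Hence: `2 ∤ c(D)` for every lattice-optimal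
conductor-level datum whose downward partner has ODD degree, i.e. `v₂(deg D) = v₂(m)`.  Application: the OPEN half of
the totally-blind `u`-family (`N = 16(u²+4)`, Kodaira I₀*, `v₂(deg) = 2` in 31/31 classes `≤ 5·10⁵`; `u² + 4` has no
prime factor `≡ 3 (mod 4)`, so ČNS alone never applies there) is discharged modulo modularity, ČNS, the conductor law of
the family and the odd-degree law of its `4 ∥ N` half (census 55/55). -/

section DownwardAndCNS

/-- isogeny bookkeeping: `(C • (W ⊗ χ₋₄)) ⊗ χ₋₄ ~ W`. -/
theorem isIsogenous_negOneTwist_smul_negOneTwist (W : WeierstrassCurve ℚ) [W.IsElliptic]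
    (C : VariableChange ℚ) :
    IsIsogenous ((C • W.quadraticTwist ((-1 : ℤ) : ℚ)).quadraticTwist ((-1 : ℤ) : ℚ)) W := by
  have hd0 : ((-1 : ℤ) : ℚ) ≠ 0 := by norm_num
  haveI := W.isElliptic_quadraticTwist hd0
  set T := W.quadraticTwist ((-1 : ℤ) : ℚ) with hT
  haveI := T.isElliptic_quadraticTwist hd0
  haveI := (C • T).isElliptic_quadraticTwist hd0
  haveI := W.isElliptic_quadraticTwist (one_ne_zero : (1 : ℚ) ≠ 0)
  have hTV : IsIsogenous T (C • T) := isIsogenous_smul T C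
  have h1 : IsIsogenous (T.quadraticTwist ((-1 : ℤ) : ℚ)) ((C • T).quadraticTwist ((-1 : ℤ) : ℚ)) :=
    hTV.quadraticTwist hd0
  have hTT : T.quadraticTwist ((-1 : ℤ) : ℚ) = W.quadraticTwist 1 := by
    rw [hT, quadraticTwist_quadraticTwist]; norm_num
  obtain ⟨C₁, hC₁⟩ := W.exists_variableChange_quadraticTwist_one
  have hW1 : IsIsogenous (W.quadraticTwist (1 : ℚ)) W := by
    rw [← hC₁]; exact (isIsogenous_smul W C₁).symm_of_charZero
  have h2 : IsIsogenous (T.quadraticTwist ((-1 : ℤ) : ℚ)) W := by rw [hTT]; exact hW1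
  exact h1.symm_of_charZero.trans' h2

/-- **DOWNWARD OPTIMAL PARTNER.**  A lattice-optimal conductor-level datum `D` on `W` with `16 ∣ N(W)` whose
`χ₋₄`-twist `T` has conductor `N(W)/m` (`m ∣ 4`, `4 ∣ N(T)`) has a lattice-optimal partner datum `D_V` on the minimal
model `V = C • T` at conductor `N(W)/m`, with the SAME Manin constant and `deg D = m · deg D_V`.  (Mirror of
`exists_optimalPartner_general`: the general two-sided lattice step instantiated with the small curve `V` carrying a
bare newform and the big curve `W` carrying `D.f`; optimal rigidity `minusOneTwistOptimalOrbit_general` + the degree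
law `modularDegree_eq_mul_of_orbit_general` for the pair `(V, W)`.) -/
theorem exists_optimalPartner_down (hnf : exists_isNewformOf)
    (W : WeierstrassCurve ℚ) [W.IsElliptic] [W.IsGloballyMinimal] [NeZero (W.conductorNorm ℤ)]
    (D : ModularParametrizationData W (W.conductorNorm ℤ)) (hD : IsLatticeOptimal D)
    (h16 : 4 ^ 2 ∣ W.conductorNorm ℤ) (m : ℕ) (hm4 : m ∣ 4)
    (hNT0 : (haveI := W.isElliptic_quadraticTwist (show ((-1 : ℤ) : ℚ) ≠ 0 by norm_num);
      m * (W.quadraticTwist ((-1 : ℤ) : ℚ)).conductorNorm ℤ) = W.conductorNorm ℤ)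
    (h4T : (haveI := W.isElliptic_quadraticTwist (show ((-1 : ℤ) : ℚ) ≠ 0 by norm_num);
      2 ^ 2 ∣ (W.quadraticTwist ((-1 : ℤ) : ℚ)).conductorNorm ℤ)) :
    ∃ (V : WeierstrassCurve ℚ) (_ : V.IsElliptic) (_ : V.IsGloballyMinimal)
      (_ : NeZero (V.conductorNorm ℤ)) (D_V : ModularParametrizationData V (V.conductorNorm ℤ)),
      IsLatticeOptimal D_V ∧ m * V.conductorNorm ℤ = W.conductorNorm ℤ ∧
      (∃ C : VariableChange ℚ, C • W.quadraticTwist ((-1 : ℤ) : ℚ) = V) ∧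
      D_V.c = D.c ∧ D.modularDegree = m * D_V.modularDegree := by
  have hm0 : m ≠ 0 := by
    rintro rfl; exact absurd (zero_dvd_iff.mp hm4) (by norm_num)
  have hd0 : ((-1 : ℤ) : ℚ) ≠ 0 := by norm_num
  haveI := W.isElliptic_quadraticTwist hd0
  set T := W.quadraticTwist ((-1 : ℤ) : ℚ) with hT
  have hNT : m * T.conductorNorm ℤ = W.conductorNorm ℤ := hNT0
  have h4W : 2 ^ 2 ∣ W.conductorNorm ℤ := dvd_trans ⟨4, by norm_num⟩ h16
  -- the minimal model `V = C • T`, `u(C)² = 1`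
  obtain ⟨C, hmin⟩ := hasGlobalMinimalModel_rat_holds T
  haveI := hmin
  have hNV : (C • T).conductorNorm ℤ = T.conductorNorm ℤ := by rw [WeierstrassCurve.conductorNorm_smul]
  haveI : NeZero (T.conductorNorm ℤ) := ⟨(T.conductorNorm_pos_holds).ne'⟩
  haveI : NeZero ((C • T).conductorNorm ℤ) := ⟨by rw [hNV]; exact NeZero.ne _⟩
  have h4V : 2 ^ 2 ∣ (C • T).conductorNorm ℤ := by rw [hNV]; exact h4T
  have hNdvd : (C • T).conductorNorm ℤ ∣ W.conductorNorm ℤ := by rw [hNV, ← hNT]; exact Dvd.intro_left m rfl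
  have hL : W.conductorNorm ℤ ∣ 4 * (C • T).conductorNorm ℤ := by
    rw [hNV, ← hNT]; exact Nat.mul_dvd_mul_right hm4 _
  have hΔ : (C • T).Δ = W.Δ := negOneTwistMinimalDiscrEq_holds W (C • T) C h4W h4V rfl
  have hu2 : ((C.u : ℚ)) ^ 2 = 1 :=
    u_sq_eq_one_of_smul_quadraticTwist_of_Δ hd0 C rfl (by rw [hΔ]; norm_num)
  have hu1 : (C.u : ℚ) = 1 ∨ (C.u : ℚ) = -1 := mul_self_eq_one_iff.mp (by rw [← pow_two]; exact hu2)
  -- the newform `g` of `V` and the two-sided lattice step for the pair (small `V`, big `W`)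
  obtain ⟨g, hg⟩ := hnf (C • T)
  have hisoV : IsIsogenous ((C • T).quadraticTwist ((-1 : ℤ) : ℚ)) W :=
    isIsogenous_negOneTwist_smul_negOneTwist W C
  obtain ⟨h₂, h₁⟩ := half_gaussSum_χ₄_twoSided_of_isNewformOf_general g hg D.f D.isNewformOf h4V h16 hNdvd hL hisoV
  -- now `h₁ : ∀ w ∈ Λ(g), s·w ∈ Λ(D.f)` and `h₂ : ∀ w ∈ Λ(D.f), s·w ∈ Λ(g)`
  set s : ℂ := gaussSum (ZMod.χ₄.ringHomComp (Int.castRingHom ℂ)) (ZMod.stdAddChar (N := 4)) / 2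
    with hs
  have hs2 : s ^ 2 = -1 := by
    rw [hs, div_pow, gaussSum_χ₄_ringHomComp_sq]; norm_num
  have hs0 : s ≠ 0 := fun h ↦ by rw [h] at hs2; norm_num at hs2
  -- Néron pairs: `Λ(T) = s⁻¹Λ(W)` (Pal), `Λ(V) = u·Λ(T)`
  have hs2' : s ^ 2 = ((((-1 : ℤ) : ℚ)) : ℂ) := by rw [hs2]; norm_num
  have hLT : IsNeronLatticeOf (T.baseChange ℂ) (D.L.mulLeft s⁻¹ (inv_ne_zero hs0)) :=
    isNeronLatticeOf_quadraticTwist_of_sq_eq ((-1 : ℤ) : ℚ) D.isNeronLattice hs0 hs2'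
  haveI : ((C • T).baseChange ℂ).IsElliptic := by rw [WeierstrassCurve.baseChange]; infer_instance
  obtain ⟨L', hL'⟩ := exists_isNeronLatticeOf_holds ((C • T).baseChange ℂ)
  have hlat := IsNeronLatticeOf.lattice_eq_mulLeft_of_smul C hLT hL'
  have huC0 : ((C.u : ℚ) : ℂ) ≠ 0 := by exact_mod_cast C.u.ne_zero
  have hmem : ∀ z : ℂ, z ∈ L'.lattice ↔ s * ((((C.u : ℚ) : ℂ))⁻¹ * z) ∈ D.L.lattice := fun z ↦ by
    rw [hlat, PeriodPair.mem_mulLeft_lattice, PeriodPair.mem_mulLeft_lattice, inv_inv]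
  have hεW : ∀ x : ℂ, (((C.u : ℚ) : ℂ))⁻¹ * x ∈ D.L.lattice ↔ x ∈ D.L.lattice := fun x ↦ by
    rcases hu1 with h | h <;> simp [h, neg_mem_iff]
  have hc0 : D.c ≠ 0 := D.maninConstant_ne_zero_holds
  -- `c·Λ(g) ⊆ Λ(V)`
  have hc : ∀ z ∈ periodLattice g, (D.c : ℂ) * z ∈ L'.lattice := fun z hz ↦ by
    rw [hmem, ← mul_assoc, mul_comm s, mul_assoc, hεW, ← mul_assoc, mul_comm s, mul_assoc]
    · exact D.smul_periodLattice_le _ (h₁ z hz)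
  obtain ⟨D', hf', hL'eq, hc'⟩ :=
    PlusEtaManinInput.exists_modularParametrizationData_eq_of_smul_periodLattice_le hg hL' hc0 hc
  subst hf' hL'eq
  -- lattice-optimality of `D′`
  have hD' : IsLatticeOptimal D' := by
    intro z hz
    rw [hmem, ← mul_assoc, mul_comm s, mul_assoc, hεW] at hz
    obtain ⟨w₀, hw₀, hzw⟩ := hD _ hz
    refine ⟨-(s * w₀), neg_mem (h₂ w₀ hw₀), ?_⟩
    rw [hc']
    have hz' : z = -(s * (s * z)) := by
      rw [← mul_assoc, ← pow_two, hs2]; ring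
    rw [hz', hzw]; ring
  -- degree: optimal rigidity for the pair `(V, W)` + the general degree law
  obtain ⟨⟨u, hu⟩, hcW⟩ := minusOneTwistOptimalOrbit_general D' D hD' hD h4V h16 hNdvd hL hisoV
  have hN0 : (C • T).conductorNorm ℤ ≠ 0 := NeZero.ne _
  have h2V : 2 ∣ (C • T).conductorNorm ℤ := dvd_trans ⟨2, by norm_num⟩ h4V
  have hψ : gamma0Index (W.conductorNorm ℤ) = m * gamma0Index ((C • T).conductorNorm ℤ) := by
    have hm124 : m = 1 ∨ m = 2 ∨ m = 4 := by
      have : m ≤ 4 := Nat.le_of_dvd (by norm_num) hm4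
      interval_cases m <;> omega
    rw [← hNT, ← hNV]
    rcases hm124 with rfl | rfl | rfl
    · simp
    · exact gamma0Index_mul_of_prime_dvd Nat.prime_two hN0 h2V
    · exact gamma0Index_four_mul_of_two_dvd hN0 h2V
  have hdeg := modularDegree_eq_mul_of_orbit_general D' D u hu hcW h4V h4W m hψ
  refine ⟨C • T, inferInstance, hmin, inferInstance, D', hD', ?_, ⟨C, rfl⟩, hc', hdeg⟩
  rw [hNV]; exact hNT

/-- **ČNS at `p = 2`, directly**: `2 ∤ deg D` and the exceptional clause void ⟹ `2 ∤ c(D)`. -/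
theorem two_not_dvd_c_of_CNS (hCNS : cesnaviciusNeururerSaha_padicVal_maninConstant_le_modularDegree)
    (W : WeierstrassCurve ℚ) [W.IsElliptic] [W.IsGloballyMinimal] [NeZero (W.conductorNorm ℤ)]
    (D : ModularParametrizationData W (W.conductorNorm ℤ))
    (hcorr : ¬ (2 ^ 3 ∣ W.conductorNorm ℤ ∧ ∀ q : ℕ, q.Prime → q ∣ W.conductorNorm ℤ → q % 4 ≠ 3))
    (hdeg : ¬ 2 ∣ D.modularDegree) : ¬ (2 : ℤ) ∣ D.c := by
  have hle := hCNS W D 2 Nat.prime_two (fun ⟨_, h8, hq⟩ ↦ hcorr ⟨h8, hq⟩)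
    (by rintro ⟨h, -⟩; norm_num at h)
  exact_mod_cast not_dvd_maninConstant_of_padicVal_le_of_not_dvd D Nat.prime_two hle hdeg

/-- **ČNS TRANSPORT ALONG THE `χ₋₄` ORBIT.**  `W` lattice-optimal at conductor `N`, `16 ∣ N`, `χ₋₄`-twist of
conductor `N/m` (`m ∣ 4`, `4 ∣ N/m`); if the exceptional clause is void DOWNSTAIRS (`¬ (8m ∣ N ∧ no q ≡ 3 (4) ∣ N)`)
and the downward partner has odd degree (`¬ 2m ∣ deg D`), then `2 ∤ c(D)`.  Modulo modularity and ČNS only. -/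
theorem two_not_dvd_c_down_of_CNS (hnf : exists_isNewformOf)
    (hCNS : cesnaviciusNeururerSaha_padicVal_maninConstant_le_modularDegree)
    (W : WeierstrassCurve ℚ) [W.IsElliptic] [W.IsGloballyMinimal] [NeZero (W.conductorNorm ℤ)]
    (D : ModularParametrizationData W (W.conductorNorm ℤ)) (hD : IsLatticeOptimal D)
    (h16 : 4 ^ 2 ∣ W.conductorNorm ℤ) (m : ℕ) (hm4 : m ∣ 4)
    (hNT0 : (haveI := W.isElliptic_quadraticTwist (show ((-1 : ℤ) : ℚ) ≠ 0 by norm_num);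
      m * (W.quadraticTwist ((-1 : ℤ) : ℚ)).conductorNorm ℤ) = W.conductorNorm ℤ)
    (h4T : (haveI := W.isElliptic_quadraticTwist (show ((-1 : ℤ) : ℚ) ≠ 0 by norm_num);
      2 ^ 2 ∣ (W.quadraticTwist ((-1 : ℤ) : ℚ)).conductorNorm ℤ))
    (hcorr : ¬ (2 ^ 3 * m ∣ W.conductorNorm ℤ ∧ ∀ q : ℕ, q.Prime → q ∣ W.conductorNorm ℤ → q % 4 ≠ 3))
    (hdeg : ¬ 2 * m ∣ D.modularDegree) : ¬ (2 : ℤ) ∣ D.c := by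
  obtain ⟨V, _, _, _, D_V, -, hNV, -, hc, hdegV⟩ := exists_optimalPartner_down hnf W D hD h16 m hm4 hNT0 h4T
  have hcorrV : ¬ (2 ^ 3 ∣ V.conductorNorm ℤ ∧
      ∀ q : ℕ, q.Prime → q ∣ V.conductorNorm ℤ → q % 4 ≠ 3) := by
    rintro ⟨h8, hq⟩
    refine hcorr ⟨?_, fun q hqp hqN ↦ ?_⟩
    · rw [← hNV, mul_comm (2 ^ 3) m]; exact Nat.mul_dvd_mul_left m h8
    · rw [← hNV] at hqN
      rcases (Nat.Prime.dvd_mul hqp).mp hqN with hqm | hqV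
      · have hq2 : q ∣ 2 ^ 2 := hqm.trans (by simpa using hm4)
        have := (Nat.prime_dvd_prime_iff_eq hqp Nat.prime_two).mp (hqp.dvd_of_dvd_pow hq2)
        subst this; norm_num
      · exact hq q hqp hqV
  have hdV : ¬ 2 ∣ D_V.modularDegree := fun h ↦ hdeg (by
    rw [hdegV, mul_comm 2 m]; exact Nat.mul_dvd_mul_left m h)
  rw [← hc]
  exact two_not_dvd_c_of_CNS hCNS V D_V hcorrV hdV

/-! ### Application: the ODD half of the totally-blind `u`-family (definitions in `CuspidalKummerUFamilyCurve.lean`) -/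

/-- **THEOREM (the odd-`u` half of E-an-50R, modulo modularity + ČNS + S-an-64 + E-an-150).**  For every
lattice-optimal conductor-level datum on a `u`-family curve with `u` odd: `2 ∤ c`.  `u ≡ 1 (4)`: ČNS directly
(`4 ∥ N`, odd degree).  `u ≡ 3 (4)`: the DOWNWARD `χ₋₄`-partner is the optimal `u`-family curve `(−u)` at `N/4`
(same `c`, `deg/4`), covered by the first case — the rotation moves the class OUT of ČNS's exceptional clause
(`u² + 4` has no prime factor `≡ 3 (mod 4)`, so at `16(u²+4)′` ČNS alone is void). -/
theorem uFamily_two_not_dvd_c_of_odd (hnf : exists_isNewformOf)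
    (hCNS : cesnaviciusNeururerSaha_padicVal_maninConstant_le_modularDegree)
    (hN : UFamilyConductorLaw) (hdeg : UFamilyOddDegreeAtFour)
    (W : WeierstrassCurve ℚ) [W.IsElliptic] [W.IsGloballyMinimal] [NeZero (W.conductorNorm ℤ)]
    (D : ModularParametrizationData W (W.conductorNorm ℤ)) (hD : IsLatticeOptimal D)
    (u : ℤ) (hu : Odd u) (hW : IsUFamilyCurve W u) : ¬ (2 : ℤ) ∣ D.c := by
  have hu4 : u % 4 = 1 ∨ u % 4 = 3 := by
    rcases hu with ⟨k, hk⟩; omega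
  rcases hu4 with h1 | h3
  · -- `4 ∥ N`: ČNS directly
    obtain ⟨-, h8⟩ := (hN W u hW).1 h1
    exact two_not_dvd_c_of_CNS hCNS W D (fun ⟨h, _⟩ ↦ h8 h) (hdeg W D u hD hW h1)
  · -- `16 ∣ N`: go down to the partner `(−u)` at `N/4`
    have hd0 : ((-1 : ℤ) : ℚ) ≠ 0 := by norm_num
    haveI := W.isElliptic_quadraticTwist hd0
    have hNT : 4 * (W.quadraticTwist ((-1 : ℤ) : ℚ)).conductorNorm ℤ = W.conductorNorm ℤ := (hN W u hW).2 h3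
    have hT : IsUFamilyCurve (W.quadraticTwist ((-1 : ℤ) : ℚ)) (-u) := isUFamilyCurve_quadraticTwist_negOne hW
    have h1' : (-u) % 4 = 1 := by omega
    obtain ⟨h4T, h8T⟩ := (hN _ (-u) hT).1 h1'
    have h16 : 4 ^ 2 ∣ W.conductorNorm ℤ := by
      rw [← hNT]; simpa [pow_two] using Nat.mul_dvd_mul_left 4 (show 4 ∣ _ by simpa using h4T)
    obtain ⟨V, _, _, _, D_V, hD_V, hNV, ⟨C, hCV⟩, hc, hdegV⟩ :=
      exists_optimalPartner_down hnf W D hD h16 4 dvd_rfl hNT h4T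
    -- `V` is again a `u`-family curve with parameter `−u`
    have hV : IsUFamilyCurve V (-u) := by
      obtain ⟨C', s', hh⟩ := hT
      refine ⟨C' * C⁻¹, s', ?_⟩
      rwa [mul_smul, ← hCV, inv_smul_smul]
    have hNVT : V.conductorNorm ℤ = (W.quadraticTwist ((-1 : ℤ) : ℚ)).conductorNorm ℤ := by
      have := hNV.trans hNT.symm; omega
    have hcorrV : ¬ (2 ^ 3 ∣ V.conductorNorm ℤ ∧
        ∀ q : ℕ, q.Prime → q ∣ V.conductorNorm ℤ → q % 4 ≠ 3) := fun ⟨h, _⟩ ↦ h8T (hNVT ▸ h)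
    rw [← hc]
    exact two_not_dvd_c_of_CNS hCNS V D_V hcorrV (hdeg V D_V (-u) hD_V hV h1')

end DownwardAndCNS

end Summit.BirchSwinnertonDyer.Rank1Residual.ManinAdditive
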